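import Literature.MathematicalPhysics.QuantumFieldTheory.Balaban1983to89.B6RandomWalk

/-!
# `Balaban1983to89.B6RandomWalkL2` — T. Bałaban, *Propagators and renormalization transformations for lattice gauge theories. II*,
# Commun. Math. Phys. **96** (1984) 223–250 [Balaban1984PropagatorsII], (2.141) p. 247: *"the series above is convergent in the norms
# appearing in the inequalities (2.136)–(2.140)"* READ FOR THE `L²` NORMS OF (2.140) — the BLOCK-`ℓ²` MAJORANT CALCULUS of the random walk
# (2.52)–(2.55)/(2.141), the `ℓ²` twin of `B6RandomWalk.HasMajorant` on the SAME carriers (file 1 of 2: sizes, pieces, majorants, composition)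

statement-level skeleton of published theorems with citation tags; proofs where landed; nothing here is a claim about the Yang–Mills mass gap

WHAT IS PRINTED (p. 247 [PDF 25], Proposition 2.6, read on the render `inprint/lit-balaban-p05/renders/cmp96/p25.png`): *"‖ζGJ‖, ‖ζ∇GJ‖, ‖ζG∇*J‖,
‖ζ∇G∇*J‖, ‖ζ∇∇GJ‖, ‖ζG∇*∇*J‖ ≤ O(1)[(Lʲη)², Lʲη, Lʲη, 1, 1, 1]|ζ|e^{−δ₃d(y,y′)}‖J‖ (2.140) if supp ζ ⊂ Δ(y), y ∈ Λ_j, supp J ⊂ Δ(y′), with the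
constant O(1) depending on d and L. The operator G can be represented as G = G₀(I − R)⁻¹ = Σ_{n=0}^∞ G₀Rⁿ = Σ_ω h_{□₀}G_{□₀}h_{□₀}·K_{□₁,□₂}G_{□₂}h_{□₂}·…·
K_{□_{2n−1},□_{2n}}G_{□_{2n}}h_{□_{2n}}, (2.141) and the series above is convergent in the norms appearing in the inequalities (2.136)–(2.140)."*; p. 232
[PDF 10] after (2.52): *"this property is preserved under the composition of operators possessing it … A summation preserves it also"*.

CITATION HEADER (lean-in-tree rule) — WHAT IS REPRODUCED.  Phase-2 file of the `lit-balaban` typed skeleton (HOME `run/shared/lean/pub/lit-balaban/`),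
seat **p22 gen 29** (free-target protocol G.5-34(d), TAKING HOME/STATUS 2026-08-24T13:26Z, cc the B6 fold owner r03 — whose 2026-08-24T08:55Z routing ask
records the `L²` slots `l2 3/4/5` of the k-level `B6.Prop26Printed` census, i.e. (2.140)₄₋₆, as UNOWNED); SKELETON row **B6.Prop2.6** × B6.Eq2.141 (cells
only; decls of record untouched).  THE READING.  The walk (2.141) is summed in `B6RandomWalk` through SUP-norm block majorants (`HasMajorant`: *"|(Tμ)(x)| ≤
K(y,y′)|μ|, x ∈ Δ(y), supp μ ⊂ Δ(y′)"*), the shape of (2.136).  The two-derivative entries (2.140)₄₋₆ have no such majorant at all (the kernels of `∇G∇*`,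
`∇∇G`, `G∇*∇*` are of Calderón–Zygmund type; cf. the HONEST SCOPE of `B6Ineq2140KLevelV1`/`…PadV1`), and print's sentence after (2.141) sums the walk in
the `L²` operator norms of (2.140) themselves, leg by leg, with the member bounds (1.114) of [Balaban1984PropagatorsI] as inputs.  THIS FILE is that
bookkeeping, on the carriers of `B6RandomWalk` (`blk : X → g.Site` the block map of p. 231, operators `Module.End ℝ (X → ℝ)`, kernels `g.Site → g.Site → ℝ`):
* §1 `l2n u` — the (unweighted) `ℓ²` size `(Σ_x u(x)²)^{1/2}` of a lattice function (the euclidean norm of `u` read in `EuclideanSpace ℝ X`): triangle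
  inequality, homogeneity, monotonicity; §1b the pieces `Δ(y)u` (`B6RandomWalk.blockPiece`) are linear in `u` and have smaller size;
* §2 **`HasL2Majorant blk T K`** — *"‖Δ(y)·Tu‖ ≤ K(y,y′)‖u‖ for supp u ⊂ Δ(y′)"*, the block-`ℓ²` shape of (2.140); monotone, additive (*"A summation
  preserves it also"*), and **`hasL2Majorant_mul`** — *"preserved under the composition"*: `T₁T₂` has the 𝔅-convolution `Σ_{y″}K₁(y,y″)K₂(y″,y′)` as
  majorant, by inserting `Σ_{y″}Δ(y″) = I` between the factors exactly as in (2.52), with NO volume factor (the triangle inequality of `ℓ²` replaces that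
  of `ℓ^∞`); powers ⇒ the closed chains `B6RandomWalk.chain` (`hasL2Majorant_pow_chain`); the identity (`hasL2Majorant_one`); `exists_l2OpBound` (every
  operator on a finite lattice is `ℓ²`-bounded — only to let `N → ∞` in the sequel); **`l2n_cut_apply_le_of_hasL2Majorant`** — the printed shape of
  (2.140) with a cut-off `ζ`, `|ζ| ≤ s`: `‖ζ·TJ‖ ≤ K(y,y′)·s·‖J‖`.
The (2.64)–(2.66)/fixed-point chain in `L²` and Prop. 2.6's *"reasoning in the same way"* for the `L²` entries are the sequel `…B6RandomWalkL2Chain`.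
Defs with bodies: `l2n` (§1), `HasL2Majorant` (§2).  No `def … : Prop` fact, no new hypothesis; standard axioms.

HONEST SCOPE / DIVERGENCES.  (1) Pure finite-dimensional bookkeeping: no operator of the paper appears; the analytic inputs of the walk (the `L²` legs of
(2.141) from (1.114) and (2.134)) are NOT here — this file is the common first brick of the unowned census slots (2.140)₄₋₆, NOT those slots.  (2) `ℓ²`
sizes are unweighted sums over the lattice `X` on both sides (print's `η^d`-weighted norms differ by the same factor on both sides).  NOT summit progress.
Unit `lit-balaban-p22` (gen 29), 2026-08-24.
-/

noncomputable section

open scoped BigOperators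
open Finset

namespace Literature.MathematicalPhysics.QuantumFieldTheory.Balaban1983to89.B6RandomWalkL2

open B6RandomWalk (BlockSupp HasMajorant blockPiece sum_blockPiece chain chain_zero chain_succ chain_nonneg chain_const_mul
  Ineq261 Ineq263 Triangle254 c1_nonneg fixedPoint_telescope const2136 delta3)

variable {g : B6.Geometry} {X : Type} [Fintype X]

/-! ## §1  The `ℓ²` size of a lattice function -/

section L2Size

/-- `‖u‖ = (Σ_x u(x)²)^{1/2}`, the (unweighted) `ℓ²` size of a function on the finite lattice `X` — the norm `‖·‖` of (2.140) (the `η`-lattice `L²` norm of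
[Balaban1984PropagatorsI] (1.114)) up to the common factor `η^{d/2}` (read as the euclidean norm of `u` in `EuclideanSpace ℝ X`).
[cite: Balaban1984PropagatorsII, (2.140) p.247 (the norm ‖·‖); Balaban1984PropagatorsI, (1.114) p.36] -/
def l2n (u : X → ℝ) : ℝ := ‖(WithLp.toLp 2 u : EuclideanSpace ℝ X)‖

/-- `‖u‖ ≥ 0`. [cite: Balaban1984PropagatorsII, (2.140) p.247 (bookkeeping, ours)] -/
theorem l2n_nonneg (u : X → ℝ) : 0 ≤ l2n u := norm_nonneg _

/-- `‖u‖² = Σ_x u(x)²`. [cite: Balaban1984PropagatorsII, (2.140) p.247 (bookkeeping, ours)] -/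
theorem l2n_sq (u : X → ℝ) : l2n u ^ 2 = ∑ x, u x ^ 2 := by
  unfold l2n
  rw [EuclideanSpace.real_norm_sq_eq]

/-- `‖0‖ = 0`. [cite: Balaban1984PropagatorsII, (2.140) p.247 (bookkeeping, ours)] -/
@[simp] theorem l2n_zero : l2n (0 : X → ℝ) = 0 := by
  unfold l2n
  rw [WithLp.toLp_zero, norm_zero]

/-- the triangle inequality. [cite: Balaban1984PropagatorsII, (2.140) p.247 (bookkeeping, ours)] -/
theorem l2n_add_le (u v : X → ℝ) : l2n (u + v) ≤ l2n u + l2n v := by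
  unfold l2n
  rw [WithLp.toLp_add]
  exact norm_add_le _ _

/-- the triangle inequality for finite sums. [cite: Balaban1984PropagatorsII, (2.140) p.247 (bookkeeping, ours)] -/
theorem l2n_sum_le {ι : Type*} (s : Finset ι) (f : ι → X → ℝ) : l2n (∑ i ∈ s, f i) ≤ ∑ i ∈ s, l2n (f i) := by
  classical
  induction s using Finset.induction_on with
  | empty => simp
  | insert a s ha ih =>
      rw [Finset.sum_insert ha, Finset.sum_insert ha]
      exact (l2n_add_le _ _).trans (by linarith)

/-- homogeneity. [cite: Balaban1984PropagatorsII, (2.140) p.247 (bookkeeping, ours)] -/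
theorem l2n_smul (c : ℝ) (u : X → ℝ) : l2n (c • u) = |c| * l2n u := by
  unfold l2n
  rw [WithLp.toLp_smul, norm_smul, Real.norm_eq_abs]

/-- monotonicity under pointwise domination `|u| ≤ |v|`. [cite: Balaban1984PropagatorsII, (2.140) p.247 (bookkeeping, ours)] -/
theorem l2n_mono {u v : X → ℝ} (h : ∀ x, |u x| ≤ |v x|) : l2n u ≤ l2n v := by
  have h2 : l2n u ^ 2 ≤ l2n v ^ 2 := by
    rw [l2n_sq, l2n_sq]
    exact Finset.sum_le_sum fun x _ => sq_le_sq.mpr (by simpa only [abs_abs] using h x)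
  have := Real.sqrt_le_sqrt h2
  rwa [Real.sqrt_sq (l2n_nonneg u), Real.sqrt_sq (l2n_nonneg v)] at this

/-- one value is at most the `ℓ²` size: `|u(x)| ≤ ‖u‖`. [cite: Balaban1984PropagatorsII, (2.140) p.247 (bookkeeping, ours)] -/
theorem abs_apply_le_l2n (u : X → ℝ) (x : X) : |u x| ≤ l2n u := by
  have h2 : |u x| ^ 2 ≤ l2n u ^ 2 := by
    rw [l2n_sq, sq_abs]
    exact Finset.single_le_sum (fun z _ => sq_nonneg (u z)) (Finset.mem_univ x)
  have := Real.sqrt_le_sqrt h2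
  rwa [Real.sqrt_sq (abs_nonneg _), Real.sqrt_sq (l2n_nonneg u)] at this

end L2Size

/-! ## §1b  Pieces `Δ(y)u` -/

section Pieces

variable (blk : X → g.Site)

omit [Fintype X] in
/-- `Δ(y)` is linear: pieces of a sum. [cite: Balaban1984PropagatorsII, (2.52) p.232 (bookkeeping, ours)] -/
theorem blockPiece_add (y : g.Site) (u v : X → ℝ) : blockPiece blk y (u + v) = blockPiece blk y u + blockPiece blk y v := by
  funext x
  by_cases hx : blk x = y <;> simp [blockPiece, hx]

omit [Fintype X] in
/-- `Δ(y)` is linear: pieces of a finite sum. [cite: Balaban1984PropagatorsII, (2.52) p.232 (bookkeeping, ours)] -/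
theorem blockPiece_sum {ι : Type*} (s : Finset ι) (y : g.Site) (f : ι → X → ℝ) :
    blockPiece blk y (∑ i ∈ s, f i) = ∑ i ∈ s, blockPiece blk y (f i) := by
  classical
  induction s using Finset.induction_on with
  | empty =>
      simp only [Finset.sum_empty]
      funext x
      by_cases hx : blk x = y <;> simp [blockPiece, hx]
  | insert a s ha ih => rw [Finset.sum_insert ha, Finset.sum_insert ha, blockPiece_add, ih]

/-- `|Δ(y)u| ≤ |u|` pointwise, hence `‖Δ(y)u‖ ≤ ‖u‖`. [cite: Balaban1984PropagatorsII, (2.52) p.232 (bookkeeping, ours)] -/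
theorem l2n_blockPiece_le (y : g.Site) (u : X → ℝ) : l2n (blockPiece blk y u) ≤ l2n u :=
  l2n_mono fun x => by
    by_cases hx : blk x = y <;> simp [blockPiece, hx]

omit [Fintype X] in
/-- a function supported in `Δ(y′)` IS its piece `Δ(y′)u`. [cite: Balaban1984PropagatorsII, (2.52) p.232 (bookkeeping, ours)] -/
theorem blockPiece_eq_self {y' : g.Site} {u : X → ℝ} (hu : ∀ x, blk x ≠ y' → u x = 0) : blockPiece blk y' u = u := by
  funext x
  by_cases hx : blk x = y'
  · simp [blockPiece, hx]
  · simp [blockPiece, hx, hu x hx]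

omit [Fintype X] in
/-- a function supported in `Δ(y′)` has no piece on another block. [cite: Balaban1984PropagatorsII, (2.52) p.232 (bookkeeping, ours)] -/
theorem blockPiece_eq_zero_of_ne {y y' : g.Site} (hne : y ≠ y') {u : X → ℝ} (hu : ∀ x, blk x ≠ y' → u x = 0) :
    blockPiece blk y u = 0 := by
  funext x
  by_cases hx : blk x = y
  · have : blk x ≠ y' := by rw [hx]; exact hne
    simp [blockPiece, hx, hu x this]
  · simp [blockPiece, hx]

omit [Fintype X] in
/-- each piece `Δ(y″)u` is supported in `Δ(y″)`. [cite: Balaban1984PropagatorsII, (2.52) p.232 (bookkeeping, ours)] -/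
theorem blockPiece_off (y'' : g.Site) (u : X → ℝ) : ∀ x, blk x ≠ y'' → blockPiece blk y'' u x = 0 := fun x hx => by
  simp [blockPiece, hx]

end Pieces

/-! ## §2  Block-`ℓ²` majorants: (2.52)/(2.55)ₐ in the `L²` norms of (2.140) -/

section Majorant

/-- THE BLOCK-`ℓ²` SHAPE OF (2.140): *"‖ζTJ‖ ≤ K(y,y′)‖J‖ if supp ζ ⊂ Δ(y), supp J ⊂ Δ(y′)"* with the sharp cut-off `ζ = Δ(y)` — the operator `T` has
the `L²` MAJORANT `K` on 𝔅 × 𝔅 with respect to the block map `blk` (the `ℓ²` twin of `B6RandomWalk.HasMajorant`; the walk (2.141) *"is convergent in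
the norms appearing in the inequalities (2.136)–(2.140)"*). [cite: Balaban1984PropagatorsII, (2.140)–(2.141) p.247 with (2.51)–(2.52) p.232] -/
def HasL2Majorant (blk : X → g.Site) (T : Module.End ℝ (X → ℝ)) (K : g.Site → g.Site → ℝ) : Prop :=
  ∀ (y y' : g.Site) (u : X → ℝ), (∀ x, blk x ≠ y' → u x = 0) → l2n (blockPiece blk y (T u)) ≤ K y y' * l2n u

variable (blk : X → g.Site)

/-- monotonicity of `L²` majorants. [cite: Balaban1984PropagatorsII, (2.52) p.232 (bookkeeping, ours)] -/
theorem hasL2Majorant_mono {T : Module.End ℝ (X → ℝ)} {K K' : g.Site → g.Site → ℝ}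
    (h : HasL2Majorant blk T K) (hle : ∀ a b, K a b ≤ K' a b) : HasL2Majorant blk T K' :=
  fun y y' u hu => (h y y' u hu).trans (mul_le_mul_of_nonneg_right (hle _ _) (l2n_nonneg u))

/-- the zero operator has the zero majorant. [cite: Balaban1984PropagatorsII, (2.52) p.232 (bookkeeping, ours)] -/
theorem hasL2Majorant_zero : HasL2Majorant blk (0 : Module.End ℝ (X → ℝ)) (fun _ _ => 0) := by
  intro y y' u hu
  have : blockPiece blk y ((0 : Module.End ℝ (X → ℝ)) u) = 0 := by
    funext x; by_cases hx : blk x = y <;> simp [blockPiece, hx]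
  rw [this, l2n_zero, zero_mul]

/-- *"A summation preserves it also"* (p. 232): `L²` majorants add. [cite: Balaban1984PropagatorsII, p.232 (after (2.52))] -/
theorem hasL2Majorant_add {T₁ T₂ : Module.End ℝ (X → ℝ)} {K₁ K₂ : g.Site → g.Site → ℝ}
    (h₁ : HasL2Majorant blk T₁ K₁) (h₂ : HasL2Majorant blk T₂ K₂) :
    HasL2Majorant blk (T₁ + T₂) (fun a b => K₁ a b + K₂ a b) := by
  intro y y' u hu
  rw [LinearMap.add_apply, blockPiece_add, add_mul]
  exact (l2n_add_le _ _).trans (add_le_add (h₁ y y' u hu) (h₂ y y' u hu))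

/-- finite sums of operators: the `L²` majorants add up. [cite: Balaban1984PropagatorsII, p.232 (after (2.52))] -/
theorem hasL2Majorant_sum (T : ℕ → Module.End ℝ (X → ℝ)) (K : ℕ → g.Site → g.Site → ℝ)
    (h : ∀ n, HasL2Majorant blk (T n) (K n)) (N : ℕ) :
    HasL2Majorant blk (∑ n ∈ Finset.range N, T n) (fun a b => ∑ n ∈ Finset.range N, K n a b) := by
  induction N with
  | zero => simpa using hasL2Majorant_zero blk
  | succ N ih =>
      have := hasL2Majorant_add blk ih (h N)
      simpa [Finset.sum_range_succ] using this

/-- **(2.52) ⇒ (2.55)ₐ IN `L²`** (p. 232: *"this property is preserved under the composition of operators possessing it"*): if `T₁` has the `L²`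
majorant `K₁ ≥ 0` and `T₂` the `L²` majorant `K₂`, then `T₁T₂` has the 𝔅-convolution `Σ_{y″}K₁(y,y″)K₂(y″,y′)` — insert `Σ_{y″}Δ(y″) = I` between the
factors and use the triangle inequality of `ℓ²` (no volume factor). [cite: Balaban1984PropagatorsII, (2.52)–(2.55) p.232, (2.141) p.247] -/
theorem hasL2Majorant_mul {T₁ T₂ : Module.End ℝ (X → ℝ)} {K₁ K₂ : g.Site → g.Site → ℝ}
    (h₁ : HasL2Majorant blk T₁ K₁) (h₂ : HasL2Majorant blk T₂ K₂) (hK₁ : ∀ a b, 0 ≤ K₁ a b) :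
    HasL2Majorant blk (T₁ * T₂) (fun a b => ∑ y'' : g.Site, K₁ a y'' * K₂ y'' b) := by
  intro y y' u hu
  have hν : ∀ y'', l2n (blockPiece blk y'' (T₂ u)) ≤ K₂ y'' y' * l2n u := fun y'' => h₂ y'' y' u hu
  have hpiece : ∀ y'' : g.Site, l2n (blockPiece blk y (T₁ (blockPiece blk y'' (T₂ u)))) ≤ K₁ y y'' * (K₂ y'' y' * l2n u) :=
    fun y'' => (h₁ y y'' _ (blockPiece_off blk y'' (T₂ u))).trans (mul_le_mul_of_nonneg_left (hν y'') (hK₁ _ _))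
  have hdec : blockPiece blk y ((T₁ * T₂) u) = ∑ y'' : g.Site, blockPiece blk y (T₁ (blockPiece blk y'' (T₂ u))) := by
    rw [Module.End.mul_apply]
    conv_lhs => rw [← sum_blockPiece blk (T₂ u), map_sum]
    rw [blockPiece_sum]
  rw [hdec]
  refine (l2n_sum_le _ _).trans ?_
  rw [Finset.sum_mul]
  refine Finset.sum_le_sum fun y'' _ => ?_
  simpa [mul_assoc] using hpiece y''

/-- the `n`-fold composition `Tⁿ` (`n = m + 1 ≥ 1` factors) of an operator with `L²` majorant `K ≥ 0` has the closed chain `chain K m` as `L²`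
majorant — (2.52)/(2.55)ₐ in `L²` for `R₁ = … = R_n`. [cite: Balaban1984PropagatorsII, (2.52)–(2.55) p.232, (2.141) p.247] -/
theorem hasL2Majorant_pow_chain {T : Module.End ℝ (X → ℝ)} {K : g.Site → g.Site → ℝ}
    (h : HasL2Majorant blk T K) (hK : ∀ a b, 0 ≤ K a b) (m : ℕ) : HasL2Majorant blk (T ^ (m + 1)) (chain K m) := by
  induction m with
  | zero =>
      intro y y' u hu
      simpa using h y y' u hu
  | succ m ih =>
      rw [pow_succ']
      have := hasL2Majorant_mul blk h ih hK
      intro y y' u hu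
      simpa [chain_succ] using this y y' u hu

/-- the identity has the `L²` majorant `1_{y = y′}` — and hence any kernel which is `≥ 1` on the diagonal and `≥ 0` off it.
[cite: Balaban1984PropagatorsII, (2.52) p.232 (bookkeeping, ours)] -/
theorem hasL2Majorant_one {K : g.Site → g.Site → ℝ} (hdiag : ∀ y, 1 ≤ K y y) (hK : ∀ a b, 0 ≤ K a b) :
    HasL2Majorant blk (1 : Module.End ℝ (X → ℝ)) K := by
  intro y y' u hu
  rw [Module.End.one_apply]
  by_cases hy : y = y'
  · subst hy
    calc l2n (blockPiece blk y u) ≤ l2n u := l2n_blockPiece_le blk y u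
      _ = 1 * l2n u := (one_mul _).symm
      _ ≤ K y y * l2n u := mul_le_mul_of_nonneg_right (hdiag y) (l2n_nonneg u)
  · rw [blockPiece_eq_zero_of_ne blk hy hu, l2n_zero]
    exact mul_nonneg (hK _ _) (l2n_nonneg u)

/-- every operator on the functions on a FINITE lattice is bounded in `ℓ²`: `‖Tu‖ ≤ E‖u‖` (expand `u` in point masses; `|u(x′)| ≤ ‖u‖`).  Used only
to pass to the limit `N → ∞` in (2.141). [cite: Balaban1984PropagatorsII, (2.141) p.247 (bookkeeping, ours)] -/
theorem exists_l2OpBound [DecidableEq X] (T : Module.End ℝ (X → ℝ)) :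
    ∃ E : ℝ, 0 ≤ E ∧ ∀ u : X → ℝ, l2n (T u) ≤ E * l2n u := by
  refine ⟨∑ x' : X, l2n (T (Pi.single x' 1)), Finset.sum_nonneg fun _ _ => l2n_nonneg _, fun u => ?_⟩
  have hdec : u = ∑ x' : X, u x' • (Pi.single x' (1 : ℝ) : X → ℝ) := by
    funext z
    rw [Finset.sum_apply]
    simp [Pi.single_apply]
  have hTu : T u = ∑ x' : X, u x' • T (Pi.single x' 1) := by
    conv_lhs => rw [hdec, map_sum]
    exact Finset.sum_congr rfl fun x' _ => by rw [map_smul]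
  rw [hTu]
  calc l2n (∑ x' : X, u x' • T (Pi.single x' 1))
      ≤ ∑ x' : X, l2n (u x' • T (Pi.single x' 1)) := l2n_sum_le _ _
    _ = ∑ x' : X, |u x'| * l2n (T (Pi.single x' 1)) := Finset.sum_congr rfl fun x' _ => l2n_smul _ _
    _ ≤ ∑ x' : X, l2n u * l2n (T (Pi.single x' 1)) :=
        Finset.sum_le_sum fun x' _ => mul_le_mul_of_nonneg_right (abs_apply_le_l2n u x') (l2n_nonneg _)
    _ = (∑ x' : X, l2n (T (Pi.single x' 1))) * l2n u := by rw [Finset.sum_mul]; exact Finset.sum_congr rfl fun _ _ => mul_comm _ _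

/-- from a block-`ℓ²` majorant to a GLOBAL `ℓ²` bound of `Tu` for `u` supported in one block: `‖Tu‖ ≤ (Σ_y K(y,y′))·‖u‖` (sum the pieces).
[cite: Balaban1984PropagatorsII, (2.52) p.232 (bookkeeping, ours)] -/
theorem l2n_apply_le_of_hasL2Majorant {T : Module.End ℝ (X → ℝ)} {K : g.Site → g.Site → ℝ} (h : HasL2Majorant blk T K)
    (y' : g.Site) (u : X → ℝ) (hu : ∀ x, blk x ≠ y' → u x = 0) : l2n (T u) ≤ (∑ y : g.Site, K y y') * l2n u := by
  calc l2n (T u) = l2n (∑ y : g.Site, blockPiece blk y (T u)) := by rw [sum_blockPiece]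
    _ ≤ ∑ y : g.Site, l2n (blockPiece blk y (T u)) := l2n_sum_le _ _
    _ ≤ ∑ y : g.Site, K y y' * l2n u := Finset.sum_le_sum fun y _ => h y y' u hu
    _ = (∑ y : g.Site, K y y') * l2n u := by rw [Finset.sum_mul]

/-- THE PRINTED SHAPE OF (2.140) from a block-`ℓ²` majorant: for a cut-off `ζ` supported in `Δ(y)` with `|ζ| ≤ s` and `J` supported in `Δ(y′)`,
`‖ζ·(TJ)‖ ≤ K(y,y′)·s·‖J‖` (pointwise `|ζ·TJ| ≤ s·|Δ(y)TJ|`). [cite: Balaban1984PropagatorsII, Prop. 2.6 (2.140) p.247] -/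
theorem l2n_cut_apply_le_of_hasL2Majorant {T : Module.End ℝ (X → ℝ)} {K : g.Site → g.Site → ℝ} (h : HasL2Majorant blk T K)
    (y y' : g.Site) (ζ J : X → ℝ) {s : ℝ} (hs : 0 ≤ s) (hζ : ∀ x, blk x ≠ y → ζ x = 0) (hζs : ∀ x, |ζ x| ≤ s)
    (hJ : ∀ x, blk x ≠ y' → J x = 0) :
    l2n (fun x => ζ x * T J x) ≤ K y y' * s * l2n J := by
  have hpt : ∀ x, |ζ x * T J x| ≤ |(s • blockPiece blk y (T J)) x| := by
    intro x
    rw [Pi.smul_apply, smul_eq_mul, abs_mul, abs_mul, abs_of_nonneg hs]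
    by_cases hx : blk x = y
    · simp only [blockPiece, hx, if_true]
      exact mul_le_mul_of_nonneg_right (hζs x) (abs_nonneg _)
    · rw [hζ x hx, abs_zero, zero_mul]
      positivity
  calc l2n (fun x => ζ x * T J x) ≤ l2n (s • blockPiece blk y (T J)) := l2n_mono hpt
    _ = |s| * l2n (blockPiece blk y (T J)) := l2n_smul _ _
    _ = s * l2n (blockPiece blk y (T J)) := by rw [abs_of_nonneg hs]
    _ ≤ s * (K y y' * l2n J) := mul_le_mul_of_nonneg_left (h y y' J hJ) hs
    _ = K y y' * s * l2n J := by ring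

/-- the same in the census `Σ`-shape of the cell's k-level (2.140) files (`B6Ineq2140KLevelV1`): `Σ_x (ζ(x)(TJ)(x))² ≤ (K(y,y′)·s)²·Σ_x J(x)²`.
[cite: Balaban1984PropagatorsII, Prop. 2.6 (2.140) p.247] -/
theorem sum_sq_cut_apply_le_of_hasL2Majorant {T : Module.End ℝ (X → ℝ)} {K : g.Site → g.Site → ℝ} (h : HasL2Majorant blk T K)
    (y y' : g.Site) (ζ J : X → ℝ) {s : ℝ} (hs : 0 ≤ s) (hζ : ∀ x, blk x ≠ y → ζ x = 0) (hζs : ∀ x, |ζ x| ≤ s)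
    (hJ : ∀ x, blk x ≠ y' → J x = 0) :
    ∑ x, (ζ x * T J x) ^ 2 ≤ (K y y' * s) ^ 2 * ∑ x, J x ^ 2 := by
  have h1 := l2n_cut_apply_le_of_hasL2Majorant blk h y y' ζ J hs hζ hζs hJ
  have h0 : 0 ≤ l2n (fun x => ζ x * T J x) := l2n_nonneg _
  have h2 := pow_le_pow_left₀ h0 h1 2
  rw [l2n_sq, mul_pow, l2n_sq] at h2
  exact h2

end Majorant

end Literature.MathematicalPhysics.QuantumFieldTheory.Balaban1983to89.B6RandomWalkL2
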